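import Literature.MathematicalPhysics.QuantumFieldTheory.Balaban1983to89.B9Eq347SupRowToL2Symmetric
import Literature.MathematicalPhysics.QuantumFieldTheory.Balaban1983to89.B9Thm34TowerVacuumLadderRows
import Literature.MathematicalPhysics.QuantumFieldTheory.Balaban1983to89.B9Eq367TowerQGGQInvLadderClosed
import Literature.MathematicalPhysics.QuantumFieldTheory.Balaban1983to89.B9Eq368TowerProjLadderClosed
import Literature.MathematicalPhysics.QuantumFieldTheory.Balaban1983to89.B9Eq349TowerCoarseRowsOfMajorant

/-!
# `Balaban1983to89.B9Eq347TowerLaddersL2` — T. Bałaban, *Propagators for lattice gauge theories in a background field*, Commun. Math. Phys. **99** (1985) 389–434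
# [Balaban1985BackgroundPropagators] Thm 3.4 p. 400 (*«describing these analytic extensions as small perturbations of the operators depending on U only»*), (3.47) p. 398,
# (3.49) p. 399, Thm 3.11 p. 416: **THE TWO-BACKGROUND LADDERS OF THE NE9 CHAIN AT THE FLAT POINT IN `L²` OPERATOR NORM, LATTICE-FREE** — for print's `k`-th-step
# site propagator `G′_k`, the third operator `c_k = (Q̃′_kG′_k²Q̃′_k†)⁻¹` and the projection `R_k`: `‖(X(U) − X(1))f‖_{L²} ≤ K·α·‖f‖_{L²}` with `K` and the window `α ≤ α_X`
# chosen BEFORE the height `n`, the spacing `η = L^{−(n+1)}`, the period `m` and the background `U` — the block-majorant ladders of this lineage (`B9Thm34TowerVacuumLadder`,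
# `B9Eq367TowerQGGQInvLadderClosed`, `B9Eq368TowerProjLadderClosed`) read as `ℓ^∞ → ℓ^∞` letters and converted WITHOUT VOLUME by the symmetric-operator bridge
# `B9Eq347SupRowToL2Symmetric` (all three differences are symmetric on the chain's weighted carriers)

statement-level skeleton of published theorems with citation tags; proofs where landed; nothing here is a claim about the Yang–Mills mass gap

CITATION HEADER (lean-in-tree rule).  Audit cell `pub-balaban`, sub-cell `t4`, BINDER row NE9; NE9 crux-team LEAF PROVER 01 (`b2b-balaban-t4-ne9-formalise-leaf-01`, gen 100;
bears_on: R4/N22).  Composition BY NAME, nothing restated: gen 99's `B9Thm34TowerVacuumLadderRows.exists_supRow_GpOfUk_sub_flat` (the `G′_k` letter), `…supRowW_of_hasMajorant_conj_readA`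
(generic read-back, fine carrier), `B9Eq367TowerQGGQInvLadderClosed.exists_hasMajorant_greenK_QGGQk_sub_flat` + `B9Eq349TowerCoarseRowsOfMajorant.supRowW_sub_of_hasMajorant_exp` (the `c_k`
letter, coarse carrier), `B9Eq368TowerProjLadderClosed.exists_hasMajorant_RofUk_sub_flat_closed` (the `R_k` majorant), `B9Eq341TowerBlockGeometry.h261_towerGeom` (row sums (2.61)),
`B9Eq347SupRowToL2Symmetric.norm_le_of_isSymmetric_of_supRow` (symmetric `ℓ^∞ → L²` bridge); symmetry by `B9Eq324DeltaPrimeATower.laplacePrimeAk_isSymmetric` + `B9Eq3124GaugeModes.greenK_isSymmetric`,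
`B9Eq326OperatorTower.RofUk_isSymmetric`, `B9Eq310HessianHermitian.adTransportW_adjoint`.  Sources: [Balaban1985BackgroundPropagators] pp. 398–400, 416 (loci only; text layer pp. 12, 19,
28 read by this lineage 2026-08-28).  Print proves Thm 3.4 by the expansions (3.57)–(3.86) and Thm 3.11 by positivity; NOTHING of those proofs is reproduced here.

WHAT IS PROVED (sorry-free; proof lane — no `def`).
* §0 [folklore] `isSymmetric_comp_comp_adjoint` (`A∘S∘A†` symmetric for symmetric `S`), `norm_le_of_isSymmetric_of_supLetter` (the bridge with the chain's `0 ≤ F` letter shape).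
* §1 **`exists_norm_GpOfUk_sub_flat_le`** — `∃ α_J > 0, K_J ≥ 0` BEFORE `n η c₀ c₁ m U α`: on print's small-field class (unitary `U`, `‖U − 1‖ ≤ αη`, the all-direction window (3.35), levels
  `ε_j ≤ αr^j`), `‖G′_k(U)f − G′_k(1)f‖ ≤ K_J·α·‖f‖` in the weight-`c₀` `L²` norm.
* §2 **`exists_norm_greenK_QGGQk_sub_flat_le`** — the same for `c_k(U) − c_k(1)` on the coarse weight-`c₁` carrier (the class of `B9Eq367TowerQGGQInvLadderClosed`).
* §3 **`exists_supRow_RofUk_sub_flat`** (the `ℓ^∞ → ℓ^∞` letter of `R_k(U) − R_k(1)`, lattice-free) and **`exists_norm_RofUk_sub_flat_le`** — the same for `R_k` in `L²`.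
HONEST SCOPE.  Composition of landed files + the [folklore] power-trick bridge; constants crude (products of the cell's closed forms, NOT print's); the Thm-3.1∕3.2 inputs are the cell's MODEL
rows («NE9 ⇐ the named binders»; O-NE9-1 #5 UNRULED); AT THE FLAT POINT only (base `V = 1`); the conjugated (non-symmetric) letter `e^{κM_S}(R_k(U) − R_k(1))e^{−κM_S}` of the OWNER's
`B9Eq326DeltaABlockDecayTowerTwoBackgroundsClosed` is NOT covered (not symmetric).  NE9 NOT PRINTED ∕ NOT PROVED; spine PROVED 0∕9; rung (B)+1 finite T⁴ — NOT infinite volume, NOT mass gap,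
NOT BetaPertH, NOT Clay.  HONEST DEPENDENCY: continuum YM on T⁴ ⇐ BetaPertH ∧ nine spine estimates (0/9 proved); BetaPertH ⇐ (D1) ∧ (D4) ∧ CAP+tail; G-an2-4 gates asym, D1 and NE2/3/4.
NEW file; nothing modified.  Net new unproved facts: 0.
-/

noncomputable section

open scoped BigOperators InnerProductSpace

namespace Literature.MathematicalPhysics.QuantumFieldTheory.Balaban1983to89.B9Eq347TowerLaddersL2

open B4Sect5Torus (TSite)
open B7Prop1Explicit (U1 Wcx boxVec)
open B9SectCLatticeCarrier (Bond shift)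
open B9Eq311L2Pairing (WL2)
open B11Eq103H1Complex (SiteL2K greenK)
open B9Eq3124GaugeModes (greenK_isSymmetric)
open B9Eq310HessianOperator (adTransportW)
open B9Eq310HessianHermitian (adTransportW_adjoint)
open B9Eq310DeltaPrime (plaqHolU)
open B9Eq315QTower (towerP UlevOf)
open B9Eq315QTorus (perCfg cornerSite)
open B9Eq326OperatorTower (QprimeTowerW RofUk RofUk_isSymmetric)
open B9Eq324DeltaPrimeATower (laplacePrimeAk laplacePrimeAk_isSymmetric GpOfUk)
open B9Eq325ProjFormulaTower (QGGQk_pos)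
open B6RandomWalk (HasMajorant Ineq261 c1_nonneg)
open B9Thm34Ext (toB6)
open B9Eq352DivFormLetters (conj conj_sub)
open B9Eq324PenaltyKernelForm (readA readA_sub)
open B9Eq341TowerBlockGeometry (towerGeom h261_towerGeom)
open B9Eq357QprimeTowerKernelForm (blkK)
open B9Eq342TowerFlatBaseMajorants (star_one_eq_inv_one)
open B9Thm34TowerVacuumLadderRows (supRowW_of_hasMajorant_conj_readA exists_supRow_GpOfUk_sub_flat)
open B9Eq367TowerQGGQInvLadderClosed (exists_hasMajorant_greenK_QGGQk_sub_flat)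
open B9Eq368TowerProjLadderClosed (exists_hasMajorant_RofUk_sub_flat_closed)
open B9Eq349TowerCoarseRowsOfMajorant (supRowW_sub_of_hasMajorant_exp)
open B9Eq347SupRowToL2Symmetric (norm_le_of_isSymmetric_of_supRow)

/-! ## §0 Two folklore lemmas -/

section Generic

variable {𝕜 : Type*} [RCLike 𝕜] {E F : Type*} [NormedAddCommGroup E] [InnerProductSpace 𝕜 E] [NormedAddCommGroup F] [InnerProductSpace 𝕜 F]
  [FiniteDimensional 𝕜 E] [FiniteDimensional 𝕜 F]

/-- `A ∘ S ∘ A†` is symmetric for a symmetric `S`. [folklore] [cite: Balaban1985BackgroundPropagators, Thm 3.11 p.416] -/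
theorem isSymmetric_comp_comp_adjoint (A : E →ₗ[𝕜] F) {S : E →ₗ[𝕜] E} (hS : S.IsSymmetric) :
    (A ∘ₗ S ∘ₗ LinearMap.adjoint A).IsSymmetric := fun x y => by
  simp only [LinearMap.comp_apply]
  rw [← LinearMap.adjoint_inner_right, hS, LinearMap.adjoint_inner_left]

end Generic

section Bridge

variable {X : Type*} [Fintype X] {V : Type*} [NormedAddCommGroup V] [InnerProductSpace ℂ V] {w : X → ℝ} [Fact (∀ x, 0 < w x)]

/-- **THE BRIDGE IN THE CHAIN's LETTER SHAPE**: a symmetric `T` on the weighted carrier with the letter `∀ f F, 0 ≤ F → (∀ x, ‖f(x)‖ ≤ F) → ∀ x, ‖(Tf)(x)‖ ≤ C·F` satisfies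
`‖Tf‖_{L²} ≤ C·‖f‖_{L²}` — `B9Eq347SupRowToL2Symmetric.norm_le_of_isSymmetric_of_supRow`, the sign condition `0 ≤ F` being automatic on a nonempty carrier and idle on an empty one.
[folklore] [cite: Balaban1985BackgroundPropagators, (3.47) p.398, (3.49) p.399, Thm 3.11 p.416] -/
theorem norm_le_of_isSymmetric_of_supLetter (T : WL2 ℂ w V →ₗ[ℂ] WL2 ℂ w V) (hT : T.IsSymmetric) {C : ℝ} (hC : 0 ≤ C)
    (hsup : ∀ (f : WL2 ℂ w V) (F : ℝ), 0 ≤ F → (∀ x, ‖WL2.equiv ℂ w V f x‖ ≤ F) → ∀ x, ‖WL2.equiv ℂ w V (T f) x‖ ≤ C * F)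
    (f : WL2 ℂ w V) : ‖T f‖ ≤ C * ‖f‖ := by
  refine norm_le_of_isSymmetric_of_supRow T hT hC (fun g F hg x => ?_) f
  exact hsup g F ((norm_nonneg _).trans (hg x)) hg x

end Bridge

/-! ## §1 `G′_k(U) − G′_k(1)` in `L²`, lattice-free -/

section Gp

variable {d : ℕ} (L : ℕ) [NeZero L] {𝔸 : Type*} [NormedRing 𝔸] [NormedAlgebra ℂ 𝔸] [CompleteSpace 𝔸] [NormOneClass 𝔸] [StarRing 𝔸] [FiniteDimensional ℂ 𝔸]
  {W : Type*} [NormedAddCommGroup W] [InnerProductSpace ℂ W] [FiniteDimensional ℂ W] (φ : W ≃ₗ[ℂ] 𝔸) {a' Mφ Mφ' : ℝ}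
  (hMφ : 0 ≤ Mφ) (hMφ' : 0 ≤ Mφ') (hφn : ∀ w, ‖φ w‖ ≤ Mφ * ‖w‖) (hφn' : ∀ X, ‖φ.symm X‖ ≤ Mφ' * ‖X‖) (ha' : 0 < a')
  {r : ℝ} (hr0 : 0 ≤ r) (hr1 : r < 1)
  (τ : 𝔸 →ₗ[ℂ] ℂ) (hτ₂ : ∀ X Y : 𝔸, τ (X * Y) = τ (Y * X)) (hφτ : ∀ X Y : 𝔸, ⟪φ.symm X, φ.symm Y⟫_ℂ = τ (star X * Y))
  {ι : Type} [Fintype ι] [DecidableEq ι] (b : Module.Basis ι ℝ 𝔸) {M₂ : ℝ} (hM₂ : 0 ≤ M₂) (hrepr : ∀ (v : 𝔸) (i : ι), |b.repr v i| ≤ M₂ * ‖v‖)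

include hMφ hMφ' hφn hφn' ha' hr0 hr1 hτ₂ hφτ hM₂ hrepr in
/-- **THE `G′_k` LADDER IN `L²`, LATTICE-FREE** — `∃ α_J > 0, K_J ≥ 0` BEFORE `n, η, m, U`: on print's small-field class of `B9Thm34TowerVacuumLadderRows.exists_supRow_GpOfUk_sub_flat` with, in
addition, `U` unitary (`star U = U⁻¹`, so that `G′_k(U)` is symmetric), for EVERY `f` of the weight-`c₀` carrier: `‖G′_k(U)f − G′_k(1)f‖ ≤ K_J·α·‖f‖` — the `ℓ^∞` letter `K_J′α` of gen 99 through
the symmetric bridge (`G′_k(U) − G′_k(1)` is symmetric: `laplacePrimeAk_isSymmetric` + `greenK_isSymmetric` at `U` and at `1`).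
[cite: Balaban1985BackgroundPropagators, Thm 3.4 p.400, (3.47) p.398, Thm 3.11 p.416] -/
theorem exists_norm_GpOfUk_sub_flat_le (hd : 1 ≤ d) (hL3 : 3 ≤ L) :
    ∃ αJ KJ : ℝ, 0 < αJ ∧ 0 ≤ KJ ∧
      ∀ (n : ℕ) (η : ℝ), η * (L : ℝ) ^ (n + 1) = 1 →
      ∀ (c₀ c₁ : ℝ) [Fact (0 < c₀)] [Fact (0 < c₁)], c₀ * ((L : ℝ) ^ (n + 1)) ^ d = c₁ →
      ∀ (m : Fin d → ℕ) [∀ i, NeZero (m i)] (U : Bond d (towerP L m (n + 1)) → 𝔸ˣ) (α : ℝ), 0 ≤ α → α ≤ αJ →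
        (∀ bd, U bd ∈ U1 𝔸) → (∀ bd, star (U bd : 𝔸) = (((U bd)⁻¹ : 𝔸ˣ) : 𝔸)) → (∀ bd, ‖(U bd : 𝔸) - 1‖ ≤ α * η) →
        (∀ (x : TSite d (towerP L m (n + 1))) (μ ν : Fin d), ‖(U (shift ν x, μ) : 𝔸) - (U (x, μ) : 𝔸)‖ ≤ α * η ^ 2) →
      ∀ (εU : ℕ → ℝ), (∀ j, 0 ≤ εU j) → (∀ j, εU j ≤ 1) → (∀ j < n + 1, εU j ≤ α * r ^ j) →
        (∀ (j : ℕ) (bd : Bond d (towerP L m (j + 1))), ‖(UlevOf L m (n + 1) U j bd : 𝔸) - 1‖ ≤ εU j) →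
        (∀ (j : ℕ) (bd : Bond d (towerP L m (j + 1))), UlevOf L m (n + 1) U j bd ∈ U1 𝔸) →
      ∀ (hposU : ∀ x : SiteL2K ℂ d (towerP L m (n + 1)) c₀ W, x ≠ 0 → 0 < RCLike.re ⟪x, laplacePrimeAk L m n φ η U a' (c₁ := c₁) x⟫_ℂ)
        (hpos₁ : ∀ x : SiteL2K ℂ d (towerP L m (n + 1)) c₀ W, x ≠ 0 →
          0 < RCLike.re ⟪x, laplacePrimeAk L m n φ η (fun _ : Bond d (towerP L m (n + 1)) => (1 : 𝔸ˣ)) a' (c₁ := c₁) x⟫_ℂ)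
        (f : SiteL2K ℂ d (towerP L m (n + 1)) c₀ W),
      ‖GpOfUk L m n φ η U a' (c₁ := c₁) hposU f - GpOfUk L m n φ η (fun _ : Bond d (towerP L m (n + 1)) => (1 : 𝔸ˣ)) a' (c₁ := c₁) hpos₁ f‖ ≤
        KJ * α * ‖f‖ := by
  obtain ⟨αJ, KJ, hαJ, hKJ, H⟩ := exists_supRow_GpOfUk_sub_flat L φ hMφ hMφ' hφn hφn' ha' hr0 hr1 τ hτ₂ hφτ b hM₂ hrepr hd hL3
  refine ⟨αJ, KJ, hαJ, hKJ, ?_⟩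
  intro n η hη c₀ c₁ _ _ hc m _ U α hα0 hαJ' hU1 hUst hUs hUw εU hε0 hε1 hεr hlev hlev1 hposU hpos₁ f
  -- symmetry of the two propagators
  have hRS := adTransportW_adjoint φ τ hτ₂ hUst hφτ
  have hRS₁ := adTransportW_adjoint φ τ hτ₂ (star_one_eq_inv_one L m n) hφτ
  have hsymU : (GpOfUk L m n φ η U a' (c₁ := c₁) hposU).IsSymmetric := by
    unfold GpOfUk; exact greenK_isSymmetric hposU (laplacePrimeAk_isSymmetric L m n φ η U a' (c₀ := c₀) (c₁ := c₁) hRS)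
  have hsym₁ : (GpOfUk L m n φ η (fun _ : Bond d (towerP L m (n + 1)) => (1 : 𝔸ˣ)) a' (c₁ := c₁) hpos₁).IsSymmetric := by
    unfold GpOfUk; exact greenK_isSymmetric hpos₁ (laplacePrimeAk_isSymmetric L m n φ η _ a' (c₀ := c₀) (c₁ := c₁) hRS₁)
  have hsym := hsymU.sub hsym₁
  have h := norm_le_of_isSymmetric_of_supLetter _ hsym (mul_nonneg hKJ hα0) (fun g F hF hg x => by
    have h1 := H n η hη c₀ c₁ hc m U α hα0 hαJ' hU1 hUs hUw εU hε0 hε1 hεr hlev hlev1 hposU hpos₁ g F hF hg x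
    rwa [LinearMap.sub_apply, WL2.equiv_sub, Pi.sub_apply]) f
  rwa [LinearMap.sub_apply] at h

end Gp

/-! ## §2 `c_k(U) − c_k(1)` in `L²`, lattice-free -/

section Ck

section Symm

variable {d : ℕ} (L : ℕ) [NeZero L] (m : Fin d → ℕ) [∀ i, NeZero (m i)] (n : ℕ)
  {𝔸 : Type*} [NormedRing 𝔸] [NormedAlgebra ℂ 𝔸] [CompleteSpace 𝔸]
  {W : Type*} [NormedAddCommGroup W] [InnerProductSpace ℂ W] [FiniteDimensional ℂ W] (φ : W ≃ₗ[ℂ] 𝔸) {c₀ c₁ : ℝ} [Fact (0 < c₀)] [Fact (0 < c₁)]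
  (η : ℝ) (V : Bond d (towerP L m (n + 1)) → 𝔸ˣ) (a' : ℝ)
  (hRSV : ∀ (bd : Bond d (towerP L m (n + 1))) (v u : W), ⟪adTransportW φ V bd v, u⟫_ℂ = ⟪v, adTransportW φ (fun bd => (V bd)⁻¹) bd u⟫_ℂ)
  (hposV : ∀ x : SiteL2K ℂ d (towerP L m (n + 1)) c₀ W, x ≠ 0 → 0 < RCLike.re ⟪x, laplacePrimeAk L m n φ η V a' (c₁ := c₁) x⟫_ℂ)

include hRSV in
/-- **Thm 3.11's third operator `Q̃′_kG′_k(V)²Q̃′_k†` IS SYMMETRIC** (`G′_k(V)` symmetric by `laplacePrimeAk_isSymmetric` + `greenK_isSymmetric`; `A∘S∘A†`). [folklore]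
[cite: Balaban1985BackgroundPropagators, Thm 3.11 p.416, (3.25) p.394] -/
theorem qggq_isSymmetric :
    (((WL2.linearEquiv ℂ ℂ (fun _ : TSite d m => c₁)).symm.toLinearMap ∘ₗ QprimeTowerW L m n φ V (c₀ := c₀)) ∘ₗ
        GpOfUk L m n φ η V a' (c₁ := c₁) hposV ∘ₗ GpOfUk L m n φ η V a' (c₁ := c₁) hposV ∘ₗ
          LinearMap.adjoint ((WL2.linearEquiv ℂ ℂ (fun _ : TSite d m => c₁)).symm.toLinearMap ∘ₗ QprimeTowerW L m n φ V (c₀ := c₀))).IsSymmetric := by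
  have hG : (GpOfUk L m n φ η V a' (c₁ := c₁) hposV).IsSymmetric := by
    unfold GpOfUk; exact greenK_isSymmetric hposV (laplacePrimeAk_isSymmetric L m n φ η V a' (c₀ := c₀) (c₁ := c₁) hRSV)
  have hGG : (GpOfUk L m n φ η V a' (c₁ := c₁) hposV ∘ₗ GpOfUk L m n φ η V a' (c₁ := c₁) hposV).IsSymmetric :=
    fun x y => by simp only [LinearMap.comp_apply]; rw [hG, hG]
  have h := isSymmetric_comp_comp_adjoint
    ((WL2.linearEquiv ℂ ℂ (fun _ : TSite d m => c₁)).symm.toLinearMap ∘ₗ QprimeTowerW L m n φ V (c₀ := c₀)) hGG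
  simpa only [LinearMap.comp_assoc] using h

end Symm

variable {d : ℕ} (L : ℕ) [NeZero L] {𝔸 : Type*} [NormedRing 𝔸] [NormedAlgebra ℂ 𝔸] [CompleteSpace 𝔸] [NormOneClass 𝔸] [StarRing 𝔸] [NormedStarGroup 𝔸] [StarModule ℂ 𝔸]
  [FiniteDimensional ℂ 𝔸]
  {W : Type*} [NormedAddCommGroup W] [InnerProductSpace ℂ W] [FiniteDimensional ℂ W] (φ : W ≃ₗ[ℂ] 𝔸) {a a' Mφ Mφ' : ℝ}
  (hMφ : 0 ≤ Mφ) (hMφ' : 0 ≤ Mφ') (hφn : ∀ w, ‖φ w‖ ≤ Mφ * ‖w‖) (hφn' : ∀ X, ‖φ.symm X‖ ≤ Mφ' * ‖X‖) (ha : 0 < a) (ha' : 0 < a')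
  {r : ℝ} (hr0 : 0 ≤ r) (hr1 : r < 1)
  (τ : 𝔸 →ₗ[ℂ] ℂ) {Cτ : ℝ} (hτ : ∀ X, ‖τ X‖ ≤ Cτ * ‖X‖) (hCτ : 0 ≤ Cτ) {ρw : ℝ} (hρw : 0 ≤ ρw)
  (hτ₁ : ∀ X : 𝔸, τ (star X) = starRingEnd ℂ (τ X)) (hτ₂ : ∀ X Y : 𝔸, τ (X * Y) = τ (Y * X)) (hφτ : ∀ X Y : 𝔸, ⟪φ.symm X, φ.symm Y⟫_ℂ = τ (star X * Y))
  {Mτ : ℝ} (hMτ : 0 ≤ Mτ)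
  {ι : Type} [Fintype ι] [DecidableEq ι] (b : Module.Basis ι ℝ 𝔸) {M₂ : ℝ} (hM₂ : 0 ≤ M₂) (hrepr : ∀ (v : 𝔸) (i : ι), |b.repr v i| ≤ M₂ * ‖v‖)

include hMφ hMφ' hφn hφn' ha ha' hr0 hr1 hτ hCτ hρw hτ₁ hτ₂ hφτ hMτ hM₂ hrepr in
/-- **THE `c_k` LADDER IN `L²`, LATTICE-FREE** — `∃ α_c > 0, K_c ≥ 0` BEFORE `n, η, m, U`: on the class of `B9Eq367TowerQGGQInvLadderClosed.exists_hasMajorant_greenK_QGGQk_sub_flat`, for EVERY `g` of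
the coarse weight-`c₁` carrier: `‖c_k(U)g − c_k(1)g‖ ≤ K_c·α·‖g‖`, `c_k = (Q̃′_kG′_k²Q̃′_k†)⁻¹ = greenK … (QGGQk_pos …)` — the block majorant of gen 99 read on the coarse carrier (blocks = sites) as the
`ℓ^∞` letter `K·c₁(d, δ, 1)·α` (`supRowW_sub_of_hasMajorant_exp`) and converted by the symmetric bridge (`c_k` is the inverse of the symmetric positive `Q̃′G′²Q̃′†`).
[cite: Balaban1985BackgroundPropagators, Thm 3.4 p.400, (3.65)–(3.67) p.403, Thm 3.2 (3.48) p.398, Thm 3.11 p.416] -/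
theorem exists_norm_greenK_QGGQk_sub_flat_le (hd : 1 ≤ d) (hL : 1 ≤ L) (hL3 : 3 ≤ L) :
    ∃ αX K : ℝ, 0 < αX ∧ 0 ≤ K ∧
      ∀ (n : ℕ) (η : ℝ), η * (L : ℝ) ^ (n + 1) = 1 →
      ∀ (c₀ c₁ : ℝ) [Fact (0 < c₀)] [Fact (0 < c₁)], c₀ * ((L : ℝ) ^ (n + 1)) ^ d = c₁ → |η| ^ d / c₀ ≤ ρw →
      ∀ (m : Fin d → ℕ) [∀ i, NeZero (m i)], (∀ i, 1 ≤ m i) → ∀ (U : Bond d (towerP L m (n + 1)) → 𝔸ˣ) (α : ℝ), 0 ≤ α → α ≤ αX →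
        (∀ bd, U bd ∈ U1 𝔸) → (∀ bd, ‖(U bd : 𝔸) - 1‖ ≤ α * η) →
        (∀ (x : TSite d (towerP L m (n + 1))) (μ ν : Fin d), ‖(U (shift ν x, μ) : 𝔸) - (U (x, μ) : 𝔸)‖ ≤ α * η ^ 2) →
        (∀ p : B9SectCLatticeCarrier.Plaq d (towerP L m (n + 1)), ‖(plaqHolU U p : 𝔸) - 1‖ ≤ α * η ^ 2) →
      ∀ (hUst : ∀ bd, star (U bd : 𝔸) = (((U bd)⁻¹ : 𝔸ˣ) : 𝔸))
        (αU : ℕ → ℝ), (∀ j, αU j ≤ 1 / 64) →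
        (∀ (j : ℕ) (x : B7Prop1Explicit.Site d) (k : Fin d), perCfg (towerP L m (j + 1)) (UlevOf L m (n + 1) U j) x k ∈ U1 𝔸) →
        (∀ (j : ℕ) (y : TSite d (towerP L m j)) (k : Fin d) (ρ' : Fin d → Fin L),
          ‖((Wcx L (perCfg (towerP L m (j + 1)) (UlevOf L m (n + 1) U j)) (cornerSite L y) k (boxVec L ρ') : 𝔸ˣ) : 𝔸) - 1‖ ≤ αU j) →
      ∀ (εU : ℕ → ℝ), (∀ j, 0 ≤ εU j) → (∀ j, εU j ≤ 1) → (∀ j < n + 1, εU j ≤ α * r ^ j) →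
        (∀ (j : ℕ) (bd : Bond d (towerP L m (j + 1))), ‖(UlevOf L m (n + 1) U j bd : 𝔸) - 1‖ ≤ εU j) →
        (∀ (j : ℕ) (bd : Bond d (towerP L m (j + 1))), UlevOf L m (n + 1) U j bd ∈ U1 𝔸) →
        (∀ (j : ℕ) (bd : Bond d (towerP L m (j + 1))) (w : W), ‖adTransportW φ (UlevOf L m (n + 1) U j) bd w‖ ≤ ‖w‖) →
      ∀ (hposU : ∀ x : SiteL2K ℂ d (towerP L m (n + 1)) c₀ W, x ≠ 0 → 0 < RCLike.re ⟪x, laplacePrimeAk L m n φ η U a' (c₁ := c₁) x⟫_ℂ)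
        (hpos₁ : ∀ x : SiteL2K ℂ d (towerP L m (n + 1)) c₀ W, x ≠ 0 →
          0 < RCLike.re ⟪x, laplacePrimeAk L m n φ η (fun _ : Bond d (towerP L m (n + 1)) => (1 : 𝔸ˣ)) a' (c₁ := c₁) x⟫_ℂ)
        (rr : TSite d m → SiteL2K ℂ d m c₁ W →L[ℂ] SiteL2K ℂ d m c₁ W),
        (∀ (y : TSite d m) (g : SiteL2K ℂ d m c₁ W) (y' : TSite d m),
          WL2.equiv ℂ (fun _ : TSite d m => c₁) W (rr y g) y' = if y' = y then WL2.equiv ℂ (fun _ : TSite d m => c₁) W g y' else 0) →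
      ∀ g : SiteL2K ℂ d m c₁ W,
      ‖greenK _ (QGGQk_pos L m n φ c₀ η U c₁ a' (adTransportW_adjoint φ τ hτ₂ hUst hφτ) hposU) g -
          greenK _ (QGGQk_pos L m n φ c₀ η (fun _ : Bond d (towerP L m (n + 1)) => (1 : 𝔸ˣ)) c₁ a' (adTransportW_adjoint φ τ hτ₂ (star_one_eq_inv_one L m n) hφτ) hpos₁) g‖ ≤
        K * α * ‖g‖ := by
  obtain ⟨αX, K, δ, hαX, hK, hδ, H⟩ :=
    exists_hasMajorant_greenK_QGGQk_sub_flat L φ hMφ hMφ' hφn hφn' ha ha' hr0 hr1 τ hτ hCτ hρw hτ₁ hτ₂ hφτ hMτ b hM₂ hrepr hd hL hL3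
  have hSb : 0 ≤ ∑ i, ‖b i‖ := Finset.sum_nonneg fun i _ => norm_nonneg _
  have hc1 : 0 ≤ B6.c1 d δ 1 := c1_nonneg d δ 1
  refine ⟨αX, Mφ' * Mφ * ((∑ i, ‖b i‖) * M₂ * (K * B6.c1 d δ 1)), hαX, by positivity, ?_⟩
  intro n η hη c₀ c₁ _ _ hc hρ m _ hm U α hα0 hαX' hU1 hUs hUw hUp hUst αU hαU hU1l hregl εU hε0 hε1 hεr hlev hlev1 hcontr hposU hpos₁ rr hrr g
  have hT := H n η hη c₀ c₁ hc hρ m hm U α hα0 hαX' hU1 hUs hUw hUp hUst αU hαU hU1l hregl εU hε0 hε1 hεr hlev hlev1 hcontr hposU hpos₁ rr hrr 0 0 True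
  -- symmetry of the two inverses: `c_k = (A∘G′∘G′∘A†)⁻¹` with `G′` symmetric
  have hRS := adTransportW_adjoint φ τ hτ₂ hUst hφτ
  have hRS₁ := adTransportW_adjoint φ τ hτ₂ (star_one_eq_inv_one L m n) hφτ
  have hsym := (greenK_isSymmetric (QGGQk_pos L m n φ c₀ η U c₁ a' hRS hposU) (qggq_isSymmetric L m n φ η U a' hRS hposU)).sub
    (greenK_isSymmetric (QGGQk_pos L m n φ c₀ η _ c₁ a' hRS₁ hpos₁) (qggq_isSymmetric L m n φ η _ a' hRS₁ hpos₁))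
  have hC : 0 ≤ Mφ' * Mφ * ((∑ i, ‖b i‖) * M₂ * (K * B6.c1 d δ 1)) * α := by positivity
  have h := norm_le_of_isSymmetric_of_supLetter _ hsym hC (fun g' F hF hg x => by
    have h1 := supRowW_sub_of_hasMajorant_exp L m n η 0 0 True φ hMφ hMφ' hφn hφn' b hM₂ hrepr _ _ (mul_nonneg hK hα0) hδ hT g' F hF hg x
    rw [LinearMap.sub_apply, WL2.equiv_sub, Pi.sub_apply]
    refine h1.trans (le_of_eq ?_)
    ring) g
  rwa [LinearMap.sub_apply] at h

end Ck

/-! ## §3 `R_k(U) − R_k(1)`: the lattice-free `ℓ^∞` letter and the `L²` bound -/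

section Rk

variable {d : ℕ} (L : ℕ) [NeZero L] {𝔸 : Type*} [NormedRing 𝔸] [NormedAlgebra ℂ 𝔸] [CompleteSpace 𝔸] [NormOneClass 𝔸] [StarRing 𝔸] [NormedStarGroup 𝔸] [StarModule ℂ 𝔸]
  [FiniteDimensional ℂ 𝔸]
  {W : Type*} [NormedAddCommGroup W] [InnerProductSpace ℂ W] [FiniteDimensional ℂ W] (φ : W ≃ₗ[ℂ] 𝔸) {a a' Mφ Mφ' : ℝ}
  (hMφ : 0 ≤ Mφ) (hMφ' : 0 ≤ Mφ') (hφn : ∀ w, ‖φ w‖ ≤ Mφ * ‖w‖) (hφn' : ∀ X, ‖φ.symm X‖ ≤ Mφ' * ‖X‖) (ha : 0 < a) (ha' : 0 < a')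
  {r : ℝ} (hr0 : 0 ≤ r) (hr1 : r < 1)
  (τ : 𝔸 →ₗ[ℂ] ℂ) {Cτ : ℝ} (hτ : ∀ X, ‖τ X‖ ≤ Cτ * ‖X‖) (hCτ : 0 ≤ Cτ) {ρw : ℝ} (hρw : 0 ≤ ρw)
  (hτ₁ : ∀ X : 𝔸, τ (star X) = starRingEnd ℂ (τ X)) (hτ₂ : ∀ X Y : 𝔸, τ (X * Y) = τ (Y * X)) (hφτ : ∀ X Y : 𝔸, ⟪φ.symm X, φ.symm Y⟫_ℂ = τ (star X * Y))
  {Mτ : ℝ} (hMτ : 0 ≤ Mτ)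
  {ι : Type} [Fintype ι] [DecidableEq ι] (b : Module.Basis ι ℝ 𝔸) {M₂ : ℝ} (hM₂ : 0 ≤ M₂) (hrepr : ∀ (v : 𝔸) (i : ι), |b.repr v i| ≤ M₂ * ‖v‖)

include hMφ hMφ' hφn hφn' ha ha' hr0 hr1 hτ hCτ hρw hτ₁ hτ₂ hφτ hMτ hM₂ hrepr in
/-- **THE `R_k` LADDER AS A LATTICE-FREE `ℓ^∞ → ℓ^∞` LETTER** — `∃ α_R > 0, K_R′ ≥ 0` BEFORE `n, η, m, U`: on the class of `B9Eq368TowerProjLadderClosed.exists_hasMajorant_RofUk_sub_flat_closed`,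
for EVERY source `f` with `‖f(y)‖_W ≤ F` and every fine site `x`: `‖(R_k(U)f)(x) − (R_k(1)f)(x)‖_W ≤ K_R′·α·F` — the block majorant `Kαe^{−δ d₁}` over `towerGeom` through the row sum
(2.61) (`h261_towerGeom`, every period) and the generic read-back `supRowW_of_hasMajorant_conj_readA`, `K_R′ = M_φ′M_φ(Σ_i‖b_i‖)M₂·K·c₁(d, δ, 1)`.
[cite: Balaban1985BackgroundPropagators, Thm 3.4 p.400, (3.68) p.403, p.398 (remark before (3.47)); Balaban1984PropagatorsII, (2.49) p.232, Lemma 2.1 (2.61) p.234] -/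
theorem exists_supRow_RofUk_sub_flat (hd : 1 ≤ d) (hL : 1 ≤ L) (hL3 : 3 ≤ L) :
    ∃ αR K : ℝ, 0 < αR ∧ 0 ≤ K ∧
      ∀ (n : ℕ) (η : ℝ), η * (L : ℝ) ^ (n + 1) = 1 →
      ∀ (c₀ c₁ : ℝ) [Fact (0 < c₀)] [Fact (0 < c₁)], c₀ * ((L : ℝ) ^ (n + 1)) ^ d = c₁ → |η| ^ d / c₀ ≤ ρw →
      ∀ (m : Fin d → ℕ) [∀ i, NeZero (m i)], (∀ i, 1 ≤ m i) → ∀ (U : Bond d (towerP L m (n + 1)) → 𝔸ˣ) (α : ℝ), 0 ≤ α → α ≤ αR →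
        (∀ bd, U bd ∈ U1 𝔸) → (∀ bd, ‖(U bd : 𝔸) - 1‖ ≤ α * η) →
        (∀ (x : TSite d (towerP L m (n + 1))) (μ ν : Fin d), ‖(U (shift ν x, μ) : 𝔸) - (U (x, μ) : 𝔸)‖ ≤ α * η ^ 2) →
        (∀ p : B9SectCLatticeCarrier.Plaq d (towerP L m (n + 1)), ‖(plaqHolU U p : 𝔸) - 1‖ ≤ α * η ^ 2) →
      ∀ (hUst : ∀ bd, star (U bd : 𝔸) = (((U bd)⁻¹ : 𝔸ˣ) : 𝔸))
        (αU : ℕ → ℝ), (∀ j, αU j ≤ 1 / 64) →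
        (∀ (j : ℕ) (x : B7Prop1Explicit.Site d) (k : Fin d), perCfg (towerP L m (j + 1)) (UlevOf L m (n + 1) U j) x k ∈ U1 𝔸) →
        (∀ (j : ℕ) (y : TSite d (towerP L m j)) (k : Fin d) (ρ' : Fin d → Fin L),
          ‖((Wcx L (perCfg (towerP L m (j + 1)) (UlevOf L m (n + 1) U j)) (cornerSite L y) k (boxVec L ρ') : 𝔸ˣ) : 𝔸) - 1‖ ≤ αU j) →
      ∀ (εU : ℕ → ℝ), (∀ j, 0 ≤ εU j) → (∀ j, εU j ≤ 1) → (∀ j < n + 1, εU j ≤ α * r ^ j) →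
        (∀ (j : ℕ) (bd : Bond d (towerP L m (j + 1))), ‖(UlevOf L m (n + 1) U j bd : 𝔸) - 1‖ ≤ εU j) →
        (∀ (j : ℕ) (bd : Bond d (towerP L m (j + 1))), UlevOf L m (n + 1) U j bd ∈ U1 𝔸) →
        (∀ (j : ℕ) (bd : Bond d (towerP L m (j + 1))) (w : W), ‖adTransportW φ (UlevOf L m (n + 1) U j) bd w‖ ≤ ‖w‖) →
      ∀ (hposU : ∀ x : SiteL2K ℂ d (towerP L m (n + 1)) c₀ W, x ≠ 0 → 0 < RCLike.re ⟪x, laplacePrimeAk L m n φ η U a' (c₁ := c₁) x⟫_ℂ)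
        (hpos₁ : ∀ x : SiteL2K ℂ d (towerP L m (n + 1)) c₀ W, x ≠ 0 →
          0 < RCLike.re ⟪x, laplacePrimeAk L m n φ η (fun _ : Bond d (towerP L m (n + 1)) => (1 : 𝔸ˣ)) a' (c₁ := c₁) x⟫_ℂ)
        (rr : TSite d m → SiteL2K ℂ d m c₁ W →L[ℂ] SiteL2K ℂ d m c₁ W),
        (∀ (y : TSite d m) (g : SiteL2K ℂ d m c₁ W) (y' : TSite d m),
          WL2.equiv ℂ (fun _ : TSite d m => c₁) W (rr y g) y' = if y' = y then WL2.equiv ℂ (fun _ : TSite d m => c₁) W g y' else 0) →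
      ∀ (f : SiteL2K ℂ d (towerP L m (n + 1)) c₀ W) (F : ℝ), 0 ≤ F →
        (∀ x, ‖WL2.equiv ℂ (fun _ : TSite d (towerP L m (n + 1)) => c₀) W f x‖ ≤ F) →
      ∀ x : TSite d (towerP L m (n + 1)),
        ‖WL2.equiv ℂ (fun _ : TSite d (towerP L m (n + 1)) => c₀) W (RofUk L m n φ η U (c₀ := c₀) f) x -
            WL2.equiv ℂ (fun _ : TSite d (towerP L m (n + 1)) => c₀) W
              (RofUk L m n φ η (fun _ : Bond d (towerP L m (n + 1)) => (1 : 𝔸ˣ)) (c₀ := c₀) f) x‖ ≤ K * α * F := by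
  obtain ⟨αR, K, δ, hαR, hK, hδ, H⟩ :=
    exists_hasMajorant_RofUk_sub_flat_closed L φ hMφ hMφ' hφn hφn' ha ha' hr0 hr1 τ hτ hCτ hρw hτ₁ hτ₂ hφτ hMτ b hM₂ hrepr hd hL hL3
  have hSb : 0 ≤ ∑ i, ‖b i‖ := Finset.sum_nonneg fun i _ => norm_nonneg _
  have hc1 : 0 ≤ B6.c1 d δ 1 := c1_nonneg d δ 1
  refine ⟨αR, Mφ' * Mφ * ((∑ i, ‖b i‖) * M₂ * (K * B6.c1 d δ 1)), hαR, by positivity, ?_⟩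
  intro n η hη c₀ c₁ _ _ hc hρ m _ hm U α hα0 hαR' hU1 hUs hUw hUp hUst αU hαU hU1l hregl εU hε0 hε1 hεr hlev hlev1 hcontr hposU hpos₁ rr hrr
    f F hF hbd x
  have hT := H n η hη c₀ c₁ hc hρ m hm U α hα0 hαR' hU1 hUs hUw hUp hUst αU hαU hU1l hregl εU hε0 hε1 hεr hlev hlev1 hcontr hposU hpos₁ rr hrr 0 0 True
  rw [← conj_sub, ← readA_sub] at hT
  have h261 : Ineq261 d (toB6 (towerGeom L m n η 0) 0 True) δ 1 := h261_towerGeom L m n η 0 0 True one_pos hδ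
  have hrow : ∀ a' : (toB6 (towerGeom L m n η 0) 0 True).Site,
      ∑ a'', K * α * Real.exp (-(δ * (towerGeom L m n η 0).dist a' a'')) ≤ K * α * B6.c1 d δ 1 := fun a' => by
    rw [← Finset.mul_sum]
    refine mul_le_mul_of_nonneg_left ?_ (mul_nonneg hK hα0)
    have h1 := h261 a'
    rw [one_mul] at h1
    exact h1
  have h := supRowW_of_hasMajorant_conj_readA φ hMφ hMφ' hφn hφn' b hM₂ hrepr (G := toB6 (towerGeom L m n η 0) 0 True) (blkK L m n)
    _ _ hT hrow f F hF hbd x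
  rw [LinearMap.sub_apply, WL2.equiv_sub, Pi.sub_apply] at h
  refine h.trans (le_of_eq ?_)
  ring

include hMφ hMφ' hφn hφn' ha ha' hr0 hr1 hτ hCτ hρw hτ₁ hτ₂ hφτ hMτ hM₂ hrepr in
/-- **THE `R_k` LADDER IN `L²`, LATTICE-FREE** — `∃ α_R > 0, K_R′ ≥ 0` BEFORE `n, η, m, U`: on the same class, for EVERY `f` of the weight-`c₀` carrier: `‖R_k(U)f − R_k(1)f‖ ≤ K_R′·α·‖f‖` —
`exists_supRow_RofUk_sub_flat` through the symmetric bridge (`R_k(U)`, `R_k(1)` are orthogonal projections: `RofUk_isSymmetric`).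
[cite: Balaban1985BackgroundPropagators, Thm 3.4 p.400, (3.68) p.403, (3.47) p.398, Thm 3.11 p.416] -/
theorem exists_norm_RofUk_sub_flat_le (hd : 1 ≤ d) (hL : 1 ≤ L) (hL3 : 3 ≤ L) :
    ∃ αR K : ℝ, 0 < αR ∧ 0 ≤ K ∧
      ∀ (n : ℕ) (η : ℝ), η * (L : ℝ) ^ (n + 1) = 1 →
      ∀ (c₀ c₁ : ℝ) [Fact (0 < c₀)] [Fact (0 < c₁)], c₀ * ((L : ℝ) ^ (n + 1)) ^ d = c₁ → |η| ^ d / c₀ ≤ ρw →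
      ∀ (m : Fin d → ℕ) [∀ i, NeZero (m i)], (∀ i, 1 ≤ m i) → ∀ (U : Bond d (towerP L m (n + 1)) → 𝔸ˣ) (α : ℝ), 0 ≤ α → α ≤ αR →
        (∀ bd, U bd ∈ U1 𝔸) → (∀ bd, ‖(U bd : 𝔸) - 1‖ ≤ α * η) →
        (∀ (x : TSite d (towerP L m (n + 1))) (μ ν : Fin d), ‖(U (shift ν x, μ) : 𝔸) - (U (x, μ) : 𝔸)‖ ≤ α * η ^ 2) →
        (∀ p : B9SectCLatticeCarrier.Plaq d (towerP L m (n + 1)), ‖(plaqHolU U p : 𝔸) - 1‖ ≤ α * η ^ 2) →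
      ∀ (hUst : ∀ bd, star (U bd : 𝔸) = (((U bd)⁻¹ : 𝔸ˣ) : 𝔸))
        (αU : ℕ → ℝ), (∀ j, αU j ≤ 1 / 64) →
        (∀ (j : ℕ) (x : B7Prop1Explicit.Site d) (k : Fin d), perCfg (towerP L m (j + 1)) (UlevOf L m (n + 1) U j) x k ∈ U1 𝔸) →
        (∀ (j : ℕ) (y : TSite d (towerP L m j)) (k : Fin d) (ρ' : Fin d → Fin L),
          ‖((Wcx L (perCfg (towerP L m (j + 1)) (UlevOf L m (n + 1) U j)) (cornerSite L y) k (boxVec L ρ') : 𝔸ˣ) : 𝔸) - 1‖ ≤ αU j) →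
      ∀ (εU : ℕ → ℝ), (∀ j, 0 ≤ εU j) → (∀ j, εU j ≤ 1) → (∀ j < n + 1, εU j ≤ α * r ^ j) →
        (∀ (j : ℕ) (bd : Bond d (towerP L m (j + 1))), ‖(UlevOf L m (n + 1) U j bd : 𝔸) - 1‖ ≤ εU j) →
        (∀ (j : ℕ) (bd : Bond d (towerP L m (j + 1))), UlevOf L m (n + 1) U j bd ∈ U1 𝔸) →
        (∀ (j : ℕ) (bd : Bond d (towerP L m (j + 1))) (w : W), ‖adTransportW φ (UlevOf L m (n + 1) U j) bd w‖ ≤ ‖w‖) →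
      ∀ (hposU : ∀ x : SiteL2K ℂ d (towerP L m (n + 1)) c₀ W, x ≠ 0 → 0 < RCLike.re ⟪x, laplacePrimeAk L m n φ η U a' (c₁ := c₁) x⟫_ℂ)
        (hpos₁ : ∀ x : SiteL2K ℂ d (towerP L m (n + 1)) c₀ W, x ≠ 0 →
          0 < RCLike.re ⟪x, laplacePrimeAk L m n φ η (fun _ : Bond d (towerP L m (n + 1)) => (1 : 𝔸ˣ)) a' (c₁ := c₁) x⟫_ℂ)
        (rr : TSite d m → SiteL2K ℂ d m c₁ W →L[ℂ] SiteL2K ℂ d m c₁ W),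
        (∀ (y : TSite d m) (g : SiteL2K ℂ d m c₁ W) (y' : TSite d m),
          WL2.equiv ℂ (fun _ : TSite d m => c₁) W (rr y g) y' = if y' = y then WL2.equiv ℂ (fun _ : TSite d m => c₁) W g y' else 0) →
      ∀ f : SiteL2K ℂ d (towerP L m (n + 1)) c₀ W,
      ‖RofUk L m n φ η U (c₀ := c₀) f - RofUk L m n φ η (fun _ : Bond d (towerP L m (n + 1)) => (1 : 𝔸ˣ)) (c₀ := c₀) f‖ ≤ K * α * ‖f‖ := by
  obtain ⟨αR, K, hαR, hK, H⟩ :=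
    exists_supRow_RofUk_sub_flat L φ hMφ hMφ' hφn hφn' ha ha' hr0 hr1 τ hτ hCτ hρw hτ₁ hτ₂ hφτ hMτ b hM₂ hrepr hd hL hL3
  refine ⟨αR, K, hαR, hK, ?_⟩
  intro n η hη c₀ c₁ _ _ hc hρ m _ hm U α hα0 hαR' hU1 hUs hUw hUp hUst αU hαU hU1l hregl εU hε0 hε1 hεr hlev hlev1 hcontr hposU hpos₁ rr hrr f
  have hsym := (RofUk_isSymmetric L m n φ η U (c₀ := c₀)).sub
    (RofUk_isSymmetric L m n φ η (fun _ : Bond d (towerP L m (n + 1)) => (1 : 𝔸ˣ)) (c₀ := c₀))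
  have h := norm_le_of_isSymmetric_of_supLetter _ hsym (mul_nonneg hK hα0) (fun g F hF hg x => by
    have h1 := H n η hη c₀ c₁ hc hρ m hm U α hα0 hαR' hU1 hUs hUw hUp hUst αU hαU hU1l hregl εU hε0 hε1 hεr hlev hlev1 hcontr hposU hpos₁ rr hrr
      g F hF hg x
    rwa [LinearMap.sub_apply, WL2.equiv_sub, Pi.sub_apply]) f
  rwa [LinearMap.sub_apply] at h

end Rk

end Literature.MathematicalPhysics.QuantumFieldTheory.Balaban1983to89.B9Eq347TowerLaddersL2

end
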